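import Summits.HodgeConjecture.HodgeConjecture.Theorems.VHCAbelianSchemesRoadSecondCarriedHGoodTypingDefs
import Literature.AlgebraicGeometry.HodgeTheory.AbelianVarietyIsogenyKernelsLattices
import HarnessLib

/-!
# Road №4 (`VHCAbelianSchemesRoad`) — THE MOVER EXISTS: `theorem hasMover (D : SecantQuotientDatum) (m : ℤ) : D.HasMover m`

research route conditional on HC_CM; not a corollary; Q11.4-sentence-2 already refuted in dim ≥ 3.

PROOFS ONLY (ring2-b03x gen 10, the ONE bounded prover seat of director-hodge g13 R13.45 (a) ∕ ring2 LEAD 161 KEY (a),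
helper `--supports stmt-HodgeConjecture-26512`; `HC_CM` nowhere; nothing about any cell, stub, crux, carrier, `HC_AV` or HC
is asserted). The typing file `VHCAbelianSchemesRoadSecondCarriedHGoodTypingDefs` (p618714) exposed exactly ONE kernel target
(its §2 (a)): the EXISTENCE of the mover `ḡ_u` of a secant–quotient datum `D` — an isogeny `g : Y → Y` of Markman's
quotient `Y = (J × Ĵ)/Ḡ` DESCENDING `u = m + φ_d ∈ ℤ[φ_d] ⊆ End(J × Ĵ)` along the quotient isogeny `q`, `q ≫ g = u ≫ q`
(`D.IsMover m g`, `D.HasMover m := ∃ g, D.IsMover m g`). This file proves it, for every datum and every `m`: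

* §1 DESCENT TO THE QUOTIENTS (general, complex abelian varieties): a homomorphism `u : A → B` mapping a finite subgroup
  `S ⊆ A[n](ℂ)` into `S' ⊆ B[n'](ℂ)` ON COMPLEX POINTS descends to the quotients, `π_S ≫ g = u ≫ π_{S'}` for a unique
  `g : A/S → B/S'` (`exists_torsionQuotHom_comp_eq_comp`, `existsUnique_…`), which is an isogeny when `u` is
  (`exists_isIsogeny_torsionQuotHom_comp_eq_comp`). The tree's universal property `AbelianVariety.exists_torsionQuotHom_comp_eq`
  (Milne I Rem. 8.12) wants `Ker π_S ⊆ Ker (u ≫ π_{S'})` on `T`-valued points for EVERY `ℂ`-scheme `T`; that scheme-theoretic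
  inclusion is obtained from the inclusion on `ℂ`-points (`Ker π_S (ℂ) = S`, Mumford §7 Thm. 4) by the tree's
  `IsIsogeny.forall_kerPoints_le_iff_kerPoints_complex_le` («kernel inclusions of isogenies are detected on complex points»,
  Milne 1986 §8: in characteristic `0` the kernel is reduced) — `kerPoints_torsionQuotHom_le_of_map_mem`.
* §2 `Ḡ` IS STABLE UNDER `φ_d` (principal `Θ`, `G₁, G₂ ⊆ A[d+1](ℂ)`): on complex points
  `φ_d(x₁ − x₂, φ_Θ(x₁ + x₂)) = (−d(x₁ + x₂), φ_Θ(x₁ − x₂)) = (x₁ + x₂, φ_Θ(x₁ − x₂))` since `−d ≡ 1 (mod d+1)`, i.e.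
  `φ_d(shear(x₁, x₂)) = shear(x₁, −x₂) ∈ Ḡ` (`comp_weilOperator_eq_rouquierShear`, `comp_weilOperator_mem_rouquierImage`);
  hence `Ḡ` is stable under every `m·𝟙 + φ_d` (`comp_zsmul_id_add_weilOperator_mem_rouquierImage`) — Markman §1.5 ∕ Lemma 9.3.3:
  «`φ_d ≡ diag(1, −1)` on `Ḡ ≅ G₁ × G₂`».
* §3 AT THE DATUM: `Ker q ⊆ Ker (u ≫ q)` scheme-theoretically (`kerPoints_q_le_kerPoints_weilEndo_comp_q`), the descent
  `exists_q_comp_eq_weilEndo_comp_q`, and **`SecantQuotientDatum.hasMover : ∀ D m, D.HasMover m`** (the descended `g` is an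
  isogeny by `IsIsogeny.of_isIsogeny_comp_eq`, `u` and `q` being isogenies); `existsUnique_isMover` with `IsMover.unique`.

Nothing here says 2m′ᵒᴴ, any stub, 26512, 26511, 23176, `HC_AV`, `HC_CM` or HC holds; HC_CM HELD, by name only.

References: [cite: Markman2025SecantWeil, §1.5 (p. 7) and §9.3 Lemma 9.3.3] [cite: MumfordAV1970, §7 Thm. 4 (p. 72)]
[cite: MilneAV2008, I §8 Rem. 8.12 (p. 39)] [cite: Milne1986AbelianVarieties, §8 (pp. 115–116)]
[cite: Lange2023AbelianVarietiesComplex, §1.1.2 proof of Prop. 1.1.15] [cite: vanGeemen1994HodgeAV, 4.9].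
-/

noncomputable section

open CategoryTheory CategoryTheory.Limits AlgebraicGeometry

namespace Summit.HodgeConjecture.HodgeConjecture.Ring2.SemiregularRepresentatives

set_option linter.dupNamespace false -- the cell's namespace repeats the summit name, as in every `Ring2*` file

open Literature.AlgebraicGeometry Literature.AlgebraicGeometry.Motives Literature.AlgebraicGeometry.Motives.AbelianVariety
open Literature.AlgebraicGeometry.HodgeTheory Literature.AlgebraicGeometry.Markman2025
open scoped MonObj

/-! ## §1 Descent of a homomorphism to the quotients by finite subgroups (complex points suffice) -/

section Descent

variable {A B : AbelianVariety ℂ} {n n' : ℕ} (hn : n ≠ 0) (hn' : n' ≠ 0)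
  (S : Subgroup (A.Points ℂ)) (hS : S ≤ A.torsionPoints ℂ n)
  (S' : Subgroup (B.Points ℂ)) (hS' : S' ≤ B.torsionPoints ℂ n')

/-- **`Ker π_S ⊆ Ker (u ≫ π_{S'})` SCHEME-THEORETICALLY from `u(S) ⊆ S'` on complex points.** For a homomorphism
`u : A → B` of complex abelian varieties mapping `S ⊆ A[n](ℂ)` into `S' ⊆ B[n'](ℂ)`, the kernel of the quotient isogeny
`π_S : A → A/S` is contained in the kernel of `u ≫ π_{S'}` on `T`-valued points for every `ℂ`-scheme `T`: on `ℂ`-points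
`Ker π_S (ℂ) = S` (Mumford §7 Thm. 4) and `π_{S'}` kills `S'`; kernel inclusions out of an isogeny are detected on complex
points (the tree's `IsIsogeny.forall_kerPoints_le_iff_kerPoints_complex_le`; Milne 1986 §8: in characteristic `0` the kernel
group scheme is reduced). [cite: MumfordAV1970, §7 Thm. 4 (p. 72)] [cite: Milne1986AbelianVarieties, §8 (pp. 115–116)] -/
theorem kerPoints_torsionQuotHom_le_of_map_mem (u : A ⟶ B)
    (hu : ∀ s ∈ S, (s ≫ u.hom.hom.hom : B.Points ℂ) ∈ S') (T : SchemeOver ℂ) :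
    Hom.kerPoints T (A.torsionQuotHom hn S hS) ≤ Hom.kerPoints T (u ≫ B.torsionQuotHom hn' S' hS') := by
  refine ((A.isIsogeny_torsionQuotHom hn S hS).forall_kerPoints_le_iff_kerPoints_complex_le
    (u ≫ B.torsionQuotHom hn' S' hS')).2 (fun x hx ↦ ?_) T
  rw [A.mem_kerPoints_torsionQuotHom_iff hn S hS] at hx
  rw [Hom.mem_kerPoints_iff]
  change (x ≫ u.hom.hom.hom) ≫ (B.torsionQuotHom hn' S' hS').hom.hom.hom = 1
  exact B.comp_torsionQuotHom_eq_one hn' S' hS' (hu x hx)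

/-- **Descent to the quotients.** A homomorphism `u : A → B` of complex abelian varieties with `u(S) ⊆ S'` on complex points,
`S ⊆ A[n](ℂ)`, `S' ⊆ B[n'](ℂ)` finite subgroups, DESCENDS: there is `g : A/S → B/S'` with `π_S ≫ g = u ≫ π_{S'}` (universal
property of `A → A/S`, Milne I Rem. 8.12, the tree's `AbelianVariety.exists_torsionQuotHom_comp_eq`, fed by
`kerPoints_torsionQuotHom_le_of_map_mem`). [cite: MilneAV2008, I §8 Rem. 8.12 (p. 39)] [cite: MumfordAV1970, §7 Thm. 4 (p. 72)] -/
theorem exists_torsionQuotHom_comp_eq_comp (u : A ⟶ B) (hu : ∀ s ∈ S, (s ≫ u.hom.hom.hom : B.Points ℂ) ∈ S') :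
    ∃ g : A.torsionQuot hn S hS ⟶ B.torsionQuot hn' S' hS',
      A.torsionQuotHom hn S hS ≫ g = u ≫ B.torsionQuotHom hn' S' hS' :=
  A.exists_torsionQuotHom_comp_eq hn S hS _ (kerPoints_torsionQuotHom_le_of_map_mem hn hn' S hS S' hS' u hu)

/-- The descended homomorphism is UNIQUE (`π_S` is an isogeny, hence an epimorphism among homomorphisms).
[cite: GortzWedhorn2023, Prop. 27.178 (1)] [cite: MilneAV2008, I §8 Rem. 8.12 (p. 39)] -/
theorem existsUnique_torsionQuotHom_comp_eq_comp (u : A ⟶ B) (hu : ∀ s ∈ S, (s ≫ u.hom.hom.hom : B.Points ℂ) ∈ S') :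
    ∃! g : A.torsionQuot hn S hS ⟶ B.torsionQuot hn' S' hS',
      A.torsionQuotHom hn S hS ≫ g = u ≫ B.torsionQuotHom hn' S' hS' := by
  obtain ⟨g, hg⟩ := exists_torsionQuotHom_comp_eq_comp hn hn' S hS S' hS' u hu
  exact ⟨g, hg, fun g' hg' ↦ A.torsionQuotHom_comp_cancel hn S hS (hg'.trans hg.symm)⟩

/-- **An ISOGENY `u` with `u(S) ⊆ S'` descends to an ISOGENY `A/S → B/S'`**: the descended `g` satisfies `π_S ≫ g = u ≫ π_{S'}`
with `π_S` and `u ≫ π_{S'}` isogenies, so `g` is an isogeny (Lange, proof of Prop. 1.1.15: «with `e_X` and `f` also `g` is an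
isogeny»; the tree's `IsIsogeny.of_isIsogeny_comp_eq`). [cite: Lange2023AbelianVarietiesComplex, §1.1.2 proof of Prop. 1.1.15 (PDF p. 22)]
[cite: MumfordAV1970, §7 Thm. 4 (p. 72)] -/
theorem exists_isIsogeny_torsionQuotHom_comp_eq_comp {u : A ⟶ B} (hiso : IsIsogeny u)
    (hu : ∀ s ∈ S, (s ≫ u.hom.hom.hom : B.Points ℂ) ∈ S') :
    ∃ g : A.torsionQuot hn S hS ⟶ B.torsionQuot hn' S' hS', IsIsogeny g ∧
      A.torsionQuotHom hn S hS ≫ g = u ≫ B.torsionQuotHom hn' S' hS' := by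
  obtain ⟨g, hg⟩ := exists_torsionQuotHom_comp_eq_comp hn hn' S hS S' hS' u hu
  exact ⟨g, (A.isIsogeny_torsionQuotHom hn S hS).of_isIsogeny_comp_eq
    (isIsogeny_comp hiso (B.isIsogeny_torsionQuotHom hn' S' hS')) hg, hg⟩

end Descent

/-! ## §2 Markman's group `Ḡ` is stable under `φ_d` and under `u = m + φ_d` -/

section Stability

variable {A : AbelianVariety ℂ} {Θ : CartierDivisor A.X.left} (hΘ : Θ.IsAmple) (hK : A.KTheta Θ = ⊥) (d : ℕ)

/-- On `T`-points, `z ≫ (n • h) = (z ≫ h) ^ n` for a homomorphism `h` of abelian varieties and `n : ℤ` (the group law on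
`Hom(P, Q)` is pointwise; `ℤ`-analogue of the tree's `comp_nsmul_id`). [cite: GortzWedhorn2023, (27.35.1)] -/
theorem comp_hom_zsmul {K : Type*} [Field K] {P Q : AbelianVariety K} {T : SchemeOver K} (z : T ⟶ P.X) (n : ℤ)
    (h : P ⟶ Q) : z ≫ (n • h).hom.hom.hom = (z ≫ h.hom.hom.hom) ^ n := by
  change z ≫ (h.hom ^ n).hom.hom = _
  rw [Grp.Hom.hom_hom_zpow, GrpObj.comp_zpow]

/-- On `T`-points, `z ≫ (−h) = (z ≫ h)⁻¹`. [cite: GortzWedhorn2023, (27.35.1)] -/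
theorem comp_hom_neg {K : Type*} [Field K] {P Q : AbelianVariety K} {T : SchemeOver K} (z : T ⟶ P.X) (h : P ⟶ Q) :
    z ≫ (-h).hom.hom.hom = (z ≫ h.hom.hom.hom)⁻¹ := by
  change z ≫ (h.hom⁻¹).hom.hom = _
  rw [Grp.Hom.hom_hom_inv, GrpObj.comp_inv]

/-- On `T`-points, `z ≫ (h + h') = (z ≫ h) * (z ≫ h')`. [cite: GortzWedhorn2023, (27.35.1)] -/
theorem comp_hom_add' {K : Type*} [Field K] {P Q : AbelianVariety K} {T : SchemeOver K} (z : T ⟶ P.X) (h h' : P ⟶ Q) :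
    z ≫ (h + h').hom.hom.hom = (z ≫ h.hom.hom.hom) * (z ≫ h'.hom.hom.hom) := by
  rw [AbelianVariety.hom_hom_hom_add, MonObj.comp_mul]

/-- **`φ_d` on a sheared pair of `(d+1)`-torsion points: `φ_d(x₁ − x₂, φ_Θ(x₁ + x₂)) = (x₁ + x₂, φ_Θ(x₁ − x₂))`**, i.e.
`φ_d(shear(x₁, x₂)) = shear(x₁, −x₂)` (multiplicatively `shear(x₁, x₂⁻¹)`): `φ_d(x, y) = (−d·φ_Θ⁻¹ y, φ_Θ x)` and
`−d ≡ 1 (mod d+1)` on `(d+1)`-torsion points (Markman: `φ_d` preserves `Ḡ ≅ G₁ × G₂`, acting as `diag(1, −1)`).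
[cite: Markman2025SecantWeil, §1.5 (p. 7) and §9.3 Lemma 9.3.3] [cite: vanGeemen1994HodgeAV, 4.9] -/
theorem comp_weilOperator_eq_rouquierShear {x₁ x₂ : A.Points ℂ} (hx₁ : x₁ ∈ A.torsionPoints ℂ (d + 1 : ℕ))
    (hx₂ : x₂ ∈ A.torsionPoints ℂ (d + 1 : ℕ)) :
    ((rouquierShear A hΘ (x₁, x₂) : (A.prod (A.dualOf Θ hΘ)).Points ℂ) ≫ (weilOperator hΘ hK d).hom.hom.hom :
        (A.prod (A.dualOf Θ hΘ)).Points ℂ) = rouquierShear A hΘ (x₁, x₂⁻¹) := by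
  haveI := A.isIso_phiTheta_of_KTheta_eq_bot hΘ hK
  set z : (A.prod (A.dualOf Θ hΘ)).Points ℂ := rouquierShear A hΘ (x₁, x₂) with hz
  apply A.pointsProj_injective (A.dualOf Θ hΘ) ℂ
  rw [pointsProj_apply, pointsProj_apply, rouquierShear_comp_fst, rouquierShear_comp_snd, inv_inv, Prod.mk.injEq]
  constructor
  · -- first component: `z ≫ φ_d ≫ p₁ = (z ≫ p₂ ≫ φ_Θ⁻¹)^(−d) = (x₁ x₂)^(−d) = x₁ x₂`
    have h1 : (z ≫ (weilOperator hΘ hK d).hom.hom.hom) ≫ (fst A (A.dualOf Θ hΘ)).hom.hom.hom =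
        z ≫ (weilOperator hΘ hK d ≫ fst A (A.dualOf Θ hΘ)).hom.hom.hom := Category.assoc _ _ _
    have h2 : z ≫ (snd A (A.dualOf Θ hΘ) ≫ inv (A.phiTheta Θ hΘ)).hom.hom.hom = x₁ * x₂ := by
      change (z ≫ (snd A (A.dualOf Θ hΘ)).hom.hom.hom) ≫ (inv (A.phiTheta Θ hΘ)).hom.hom.hom = x₁ * x₂
      rw [hz, rouquierShear_comp_snd, IsMonHom.monoidHom_apply]
      change (x₁ * x₂) ≫ (A.phiTheta Θ hΘ ≫ inv (A.phiTheta Θ hΘ)).hom.hom.hom = x₁ * x₂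
      rw [IsIso.hom_inv_id]
      exact Category.comp_id _
    rw [h1, weilOperator_fst, comp_hom_neg, comp_hom_zsmul, h2]
    have e₁ : x₁ ^ ((d + 1 : ℕ) : ℤ) = 1 := (mem_torsionPoints_iff _ _).1 hx₁
    have e₂ : x₂ ^ ((d + 1 : ℕ) : ℤ) = 1 := (mem_torsionPoints_iff _ _).1 hx₂
    have e : (x₁ * x₂) ^ ((d + 1 : ℕ) : ℤ) = 1 := by rw [mul_zpow, e₁, e₂, mul_one]
    calc ((x₁ * x₂) ^ (d : ℤ))⁻¹ = ((x₁ * x₂) ^ (d : ℤ))⁻¹ * (x₁ * x₂) ^ ((d + 1 : ℕ) : ℤ) := by rw [e, mul_one]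
      _ = x₁ * x₂ := by rw [← zpow_neg, ← zpow_add]; norm_num
  · -- second component: `z ≫ φ_d ≫ p₂ = (z ≫ p₁) ≫ φ_Θ = φ_Θ(x₁ x₂⁻¹)`
    have h1 : (z ≫ (weilOperator hΘ hK d).hom.hom.hom) ≫ (snd A (A.dualOf Θ hΘ)).hom.hom.hom =
        z ≫ (weilOperator hΘ hK d ≫ snd A (A.dualOf Θ hΘ)).hom.hom.hom := Category.assoc _ _ _
    rw [h1, weilOperator_snd]
    change (z ≫ (fst A (A.dualOf Θ hΘ)).hom.hom.hom) ≫ (A.phiTheta Θ hΘ).hom.hom.hom = _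
    rw [hz, rouquierShear_comp_fst, IsMonHom.monoidHom_apply]

variable {G₁ G₂ : Subgroup (A.Points ℂ)} (h₁ : G₁ ≤ A.torsionPoints ℂ (d + 1 : ℕ)) (h₂ : G₂ ≤ A.torsionPoints ℂ (d + 1 : ℕ))
include h₁ h₂

/-- **`φ_d(Ḡ) ⊆ Ḡ`** on complex points, for `G₁, G₂ ⊆ A[d+1](ℂ)` and principal `Θ` (`φ_d(shear(x₁, x₂)) = shear(x₁, −x₂)`).
[cite: Markman2025SecantWeil, §1.5 (p. 7) and §9.3 Lemma 9.3.3] -/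
theorem comp_weilOperator_mem_rouquierImage {z : (A.prod (A.dualOf Θ hΘ)).Points ℂ} (hz : z ∈ rouquierImage A hΘ G₁ G₂) :
    (z ≫ (weilOperator hΘ hK d).hom.hom.hom : (A.prod (A.dualOf Θ hΘ)).Points ℂ) ∈ rouquierImage A hΘ G₁ G₂ := by
  obtain ⟨x₁, hx₁, x₂, hx₂, rfl⟩ := (mem_rouquierImage_iff z).1 hz
  rw [comp_weilOperator_eq_rouquierShear hΘ hK d (h₁ hx₁) (h₂ hx₂)]
  exact rouquierShear_mem_rouquierImage hx₁ (inv_mem hx₂)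

/-- **`u(Ḡ) ⊆ Ḡ` for every `u = m·𝟙 + φ_d ∈ ℤ[φ_d]`** on complex points (`Ḡ` is a subgroup stable under `φ_d`).
[cite: Markman2025SecantWeil, §1.5 (p. 7) and §9.3 Lemma 9.3.3] [cite: vanGeemen1994HodgeAV, 4.9] -/
theorem comp_zsmul_id_add_weilOperator_mem_rouquierImage (m : ℤ) {z : (A.prod (A.dualOf Θ hΘ)).Points ℂ}
    (hz : z ∈ rouquierImage A hΘ G₁ G₂) :
    (z ≫ (m • 𝟙 (A.prod (A.dualOf Θ hΘ)) + weilOperator hΘ hK d).hom.hom.hom : (A.prod (A.dualOf Θ hΘ)).Points ℂ) ∈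
      rouquierImage A hΘ G₁ G₂ := by
  rw [comp_hom_add', comp_hom_zsmul]
  refine mul_mem (zpow_mem ?_ m) (comp_weilOperator_mem_rouquierImage hΘ hK d h₁ h₂ hz)
  change z ≫ 𝟙 _ ∈ rouquierImage A hΘ G₁ G₂
  rwa [Category.comp_id]

end Stability

/-! ## §3 The mover of a secant–quotient datum exists -/

namespace SecantQuotientDatum

variable (D : SecantQuotientDatum)

/-- `u = m + φ_d` maps `Ḡ` into `Ḡ` on complex points, at the datum. [cite: Markman2025SecantWeil, §1.5 (p. 7) and §9.3 Lemma 9.3.3] -/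
theorem comp_weilEndo_mem_rouquierImage (m : ℤ) {z : D.P.Points ℂ} (hz : z ∈ rouquierImage D.𝒥.J D.isAmple D.G₁ D.G₂) :
    (z ≫ (D.weilEndo m).hom.hom.hom : D.P.Points ℂ) ∈ rouquierImage D.𝒥.J D.isAmple D.G₁ D.G₂ :=
  comp_zsmul_id_add_weilOperator_mem_rouquierImage D.isAmple D.KTheta_eq_bot D.d D.G₁_le D.G₂_le m hz

/-- **`Ker q ⊆ Ker (u ≫ q)` scheme-theoretically** (on `T`-valued points for every `ℂ`-scheme `T`), `u = m + φ_d`: the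
hypothesis of the universal property of `q : J × Ĵ → Y = (J × Ĵ)/Ḡ`. [cite: MilneAV2008, I §8 Rem. 8.12 (p. 39)]
[cite: Markman2025SecantWeil, §1.5 (p. 7)] -/
theorem kerPoints_q_le_kerPoints_weilEndo_comp_q (m : ℤ) (T : SchemeOver ℂ) :
    Hom.kerPoints T D.q ≤ Hom.kerPoints T (D.weilEndo m ≫ D.q) :=
  kerPoints_torsionQuotHom_le_of_map_mem D.succ_ne_zero D.succ_ne_zero _ (rouquierImage_le_torsionPoints D.G₁_le D.G₂_le)
    _ (rouquierImage_le_torsionPoints D.G₁_le D.G₂_le) (D.weilEndo m) (fun _ hs ↦ D.comp_weilEndo_mem_rouquierImage m hs) T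

/-- **`u = m + φ_d` descends along `q`**: there is `g : Y → Y` with `q ≫ g = u ≫ q`. [cite: Markman2025SecantWeil, §1.5 (p. 7) and §9.3 Lemma 9.3.3]
[cite: MilneAV2008, I §8 Rem. 8.12 (p. 39)] -/
theorem exists_q_comp_eq_weilEndo_comp_q (m : ℤ) : ∃ g : D.Y ⟶ D.Y, D.q ≫ g = D.weilEndo m ≫ D.q :=
  exists_torsionQuotHom_comp_eq_comp D.succ_ne_zero D.succ_ne_zero _ (rouquierImage_le_torsionPoints D.G₁_le D.G₂_le)
    _ (rouquierImage_le_torsionPoints D.G₁_le D.G₂_le) (D.weilEndo m) (fun _ hs ↦ D.comp_weilEndo_mem_rouquierImage m hs)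

/-- **THE MOVER EXISTS: `D.HasMover m` for every secant–quotient datum `D` and every `m : ℤ`** — the isogeny
`u = m + φ_d` of `J × Ĵ` preserves `Ḡ` (§2), hence descends along the quotient isogeny `q : J × Ĵ → Y = (J × Ĵ)/Ḡ` to a
homomorphism `ḡ_u : Y → Y` with `q ≫ ḡ_u = u ≫ q` (§1), which is an isogeny since `q` and `u ≫ q` are. This discharges the
hypothesis `D.HasMover m` of the typing file (its §2 (a): «existence of `ḡ_u`, NOT constructed»); with `IsMover.unique` the
mover is well defined. [cite: Markman2025SecantWeil, §1.5 (p. 7) and §9.3 Lemma 9.3.3] [cite: MilneAV2008, I §8 Rem. 8.12 (p. 39)]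
[cite: Lange2023AbelianVarietiesComplex, §1.1.2 proof of Prop. 1.1.15 (PDF p. 22)] -/
theorem hasMover (m : ℤ) : D.HasMover m := by
  obtain ⟨g, hg, h⟩ := exists_isIsogeny_torsionQuotHom_comp_eq_comp D.succ_ne_zero D.succ_ne_zero
    _ (rouquierImage_le_torsionPoints D.G₁_le D.G₂_le) _ (rouquierImage_le_torsionPoints D.G₁_le D.G₂_le)
    (D.isIsogeny_weilEndo m) (fun _ hs ↦ D.comp_weilEndo_mem_rouquierImage m hs)
  exact ⟨g, hg, h⟩

/-- The mover exists AND is unique. [cite: Markman2025SecantWeil, §1.5 (p. 7)] [cite: GortzWedhorn2023, Prop. 27.178 (1)] -/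
theorem existsUnique_isMover (m : ℤ) : ∃! g : D.Y ⟶ D.Y, D.IsMover m g := by
  obtain ⟨g, hg⟩ := D.hasMover m
  exact ⟨g, hg, fun g' hg' ↦ hg'.unique hg⟩

/-- In particular THEOREM M's mover `ḡ_{2+φ₄}` (`m = 2`) and the d-uniform mover `ḡ_{3+φ_d}` (`m = 3`) exist at every datum.
[cite: Markman2025SecantWeil, §1.3 and Thm. 1.4.1 (item 4)] -/
theorem hasMover_two_and_three : D.HasMover 2 ∧ D.HasMover 3 := ⟨D.hasMover 2, D.hasMover 3⟩

end SecantQuotientDatum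

end Summit.HodgeConjecture.HodgeConjecture.Ring2.SemiregularRepresentatives

end
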